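import Summits.BirchSwinnertonDyer.BirchSwinnertonDyer.Theorems.PrintCf2RubinValueTwoLinePinCharIdealAwayCalculus
import HarnessLib

/-!
# M-LINE-PIN / (α3) ROW 2, FILE 4a: the ALGEBRAIC SKELETON of ROW 2 — `char Q ≐ char(H/Z)` from a comparison
# `g : Q → H/C̃` with away-from-`ϖ`-null kernel and cokernel and the ONE displayed hypothesis hCR (`C̃ ≐ Z`)

Cell `bsd-print-cf2`, WIDTH seat `bsd-line-cf2-p1-w6` g8 (prover-bsd-line-cf2-p1-w6-g8-0); (α3) ROW 2 on the DECIDING child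
stmt-BirchSwinnertonDyer-24721 (planner ruling R2-7 (O3), STATUS 13:26:09Z: ROW 2 = kernel + ONE displayed hypothesis hCR «Kummer images of
Rubin's `𝒞̄_∞^θ` and `ℐ𝒥·ζ` agree up to away-from-`(2)`-null»); `--supports` that item (helper, Theses-free). HONEST FRAMING: commutative algebra
only (the tree's away-calculus `FourTerm.exists_charIdeal_mul_pow_eq_of_*`); nothing about BSD. THEOREMS ONLY.

SHAPE (all modules over a Noetherian domain `R` with a prime element `ϖ`; in the cell `R = Λ₂ = ℤ_2⟦T₁,T₂⟧`, `ϖ = 2`): `Q` = Rubin's `(ℰ_∞/𝒞_∞)^θ`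
(`UnitIndexData₂.Q`), `H` = ty2's `IwasawaCohomologyData … 1 .H` (`H¹(𝒪_K[1/p𝔣], Λ(θ)(1))`), `Z ≤ H` = the zeta submodule `ℐ𝒥·ζ` (F0b), `C ≤ H` = `C̃`
= the elements all of whose layer components lie in the Kummer images of the elliptic units (ROW 2 FILES 2–3), `g : Q → H/C̃` the lift of FILE 2
(`RowTwo.exists_lift`) read modulo `C̃`. The displayed hypothesis **hCR** is the pair
`hCZ : ∀ 𝔭 (ht 𝔭 ≤ 1) (ϖ ∉ 𝔭), ∀ z ∈ Z, ∃ r ∉ 𝔭, r • z ∈ C` («`Z ⊆ C̃` away from `ϖ`») and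
`hZC : ∀ 𝔭 (ht 𝔭 ≤ 1) (ϖ ∉ 𝔭), ∀ c ∈ C, ∃ r ∉ 𝔭, r • c ∈ Z` («`C̃ ⊆ Z` away from `ϖ`»).

* `isTorsion_quotient_of_away` — `H/C` is torsion when `H/Z` is and `Z ⊆ C` away from `ϖ`.
* `exists_charIdeal_quotient_mul_pow_eq_quotient_sup` — `char(H/C) ≐ char(H/(C ⊔ Z))` from `hCZ`.
* `exists_charIdeal_mul_pow_eq_of_lift_of_hCR` — **ROW 2's relation `hrow2`**: `∃ i i', char Q·(ϖ)^i = char(H/Z)·(ϖ)^{i'}` from `g`, its two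
  defect estimates, and hCR — VERBATIM the binder `hrow2` of `JLKDescent.exists_charIdeal_mul_pow_eq_of_descent_rel`.

References: Neukirch–Schmidt–Wingberg (2008) V §1 (5.1.4)–(5.1.6), §3 (5.3.9)–(5.3.10); J. Johnson-Leung, G. Kings (2011) §5.4.
-/

noncomputable section

-- the summit namespace `Summit.BirchSwinnertonDyer.BirchSwinnertonDyer` repeats the problem name by design (D-0017)
set_option linter.dupNamespace false
set_option autoImplicit false

namespace Summit.BirchSwinnertonDyer.BirchSwinnertonDyer.Theorems.PrintCf2.RowTwo

open FourTerm Literature.NumberTheory.EllipticCurves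

universe u₁ u₂

variable {R : Type*} [CommRing R] [IsNoetherianRing R] [IsDomain R] {ϖ : R}
  {Q : Type u₁} [AddCommGroup Q] [Module R Q] {H : Type u₂} [AddCommGroup H] [Module R H]

omit [IsNoetherianRing R] in
/-- **`H/C` is torsion** if `H/Z` is torsion and every `z ∈ Z` has a non-zero multiple in `C` (the away-hypothesis `hCZ` read at the prime `(0)`).
[cite: NeukirchSchmidtWingberg2008, Ch. V §1, (5.1.4)] -/
theorem isTorsion_quotient_of_away (hϖ : Prime ϖ) (Z C : Submodule R H) (hHZ : Module.IsTorsion R (H ⧸ Z))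
    (hCZ : ∀ 𝔭 : PrimeSpectrum R, 𝔭.asIdeal.height ≤ 1 → ϖ ∉ 𝔭.asIdeal → ∀ z ∈ Z, ∃ r ∉ 𝔭.asIdeal, r • z ∈ C) :
    Module.IsTorsion R (H ⧸ C) := by
  intro x
  induction x using Submodule.Quotient.induction_on with | H h => ?_
  obtain ⟨⟨s, hs⟩, hsx⟩ := @hHZ (Submodule.Quotient.mk h)
  have hsz : s • h ∈ Z := by
    rw [← Submodule.Quotient.mk_eq_zero, Submodule.Quotient.mk_smul]
    rwa [Submonoid.mk_smul] at hsx
  have h0 : (⟨⊥, Ideal.isPrime_bot⟩ : PrimeSpectrum R).asIdeal.height ≤ 1 := by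
    change (⊥ : Ideal R).height ≤ 1
    rw [Ideal.height_bot]; exact zero_le_one
  obtain ⟨r, hr, hrC⟩ := hCZ ⟨⊥, Ideal.isPrime_bot⟩ h0 (by simpa using hϖ.ne_zero) _ hsz
  have hr0 : r ≠ 0 := by simpa using hr
  refine ⟨⟨r * s, mem_nonZeroDivisors_of_ne_zero (mul_ne_zero hr0 (nonZeroDivisors.ne_zero hs))⟩, ?_⟩
  rw [Submonoid.mk_smul, ← Submodule.Quotient.mk_smul, Submodule.Quotient.mk_eq_zero, mul_smul]
  exact hrC

/-- **`char(H/C) ≐ char(H/(C ⊔ Z))`** when `Z ⊆ C` away from `ϖ`: the quotient map `H/C ↠ H/(C ⊔ Z)` has kernel `(C + Z)/C`, killed pointwise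
away from `ϖ` by `hCZ`. [cite: NeukirchSchmidtWingberg2008, Ch. V §3, (5.3.9)–(5.3.10)] -/
theorem exists_charIdeal_quotient_mul_pow_eq_quotient_sup (hϖ : Prime ϖ) (Z C : Submodule R H)
    [Module.Finite R (H ⧸ C)] (hHC : Module.IsTorsion R (H ⧸ C))
    (hCZ : ∀ 𝔭 : PrimeSpectrum R, 𝔭.asIdeal.height ≤ 1 → ϖ ∉ 𝔭.asIdeal → ∀ z ∈ Z, ∃ r ∉ 𝔭.asIdeal, r • z ∈ C) :
    ∃ i j : ℕ, Module.charIdeal R (H ⧸ C) * Ideal.span {ϖ} ^ i = Module.charIdeal R (H ⧸ (C ⊔ Z)) * Ideal.span {ϖ} ^ j := by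
  refine exists_charIdeal_mul_pow_eq_of_surjective_of_away hϖ hHC
    (Submodule.mapQ C (C ⊔ Z) LinearMap.id fun x hx ↦ Submodule.mem_sup_left hx) ?_ ?_
  · intro y
    induction y using Submodule.Quotient.induction_on with | H h => ?_
    exact ⟨Submodule.Quotient.mk h, rfl⟩
  · intro 𝔭 h𝔭 hϖ𝔭 x hx
    induction x using Submodule.Quotient.induction_on with | H h => ?_
    rw [Submodule.mapQ_apply, LinearMap.id_apply, Submodule.Quotient.mk_eq_zero, Submodule.mem_sup] at hx
    obtain ⟨c, hc, z, hz, rfl⟩ := hx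
    obtain ⟨r, hr, hrz⟩ := hCZ 𝔭 h𝔭 hϖ𝔭 z hz
    refine ⟨r, hr, ?_⟩
    rw [← Submodule.Quotient.mk_smul, Submodule.Quotient.mk_eq_zero, smul_add]
    exact add_mem (C.smul_mem r hc) hrz

/-- **ROW 2's `char`-relation from the lift and hCR.** Over a Noetherian domain `R` with a prime `ϖ`: `Q`, `H` finitely generated, `Z, C ≤ H`
with `H/Z` torsion, a linear `g : Q → H/C` whose kernel and cokernel are away-from-`ϖ`-null pointwise (at every prime `𝔭` of height `≤ 1` with
`ϖ ∉ 𝔭`), and **hCR** = (`hCZ` : `Z ⊆ C` away from `ϖ`) ∧ (`hZC` : `C ⊆ Z` away from `ϖ`) ⟹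
`∃ i i', char Q·(ϖ)^i = char(H/Z)·(ϖ)^{i'}` (zigzag `Q → H/C ↠ H/(C ⊔ Z) ↞ H/Z`).
[cite: NeukirchSchmidtWingberg2008, Ch. V §1, (5.1.4)–(5.1.6); §3, (5.3.9)–(5.3.10)] [cite: JohnsonLeungKings2011, §5.4 (arXiv p0015:L159–161)] -/
theorem exists_charIdeal_mul_pow_eq_of_lift_of_hCR (hϖ : Prime ϖ)
    [Module.Finite R Q] (hQ : Module.IsTorsion R Q) [Module.Finite R H] (Z C : Submodule R H) (hHZ : Module.IsTorsion R (H ⧸ Z))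
    (g : Q →ₗ[R] H ⧸ C)
    (hgker : ∀ 𝔭 : PrimeSpectrum R, 𝔭.asIdeal.height ≤ 1 → ϖ ∉ 𝔭.asIdeal → ∀ q : Q, g q = 0 → ∃ r ∉ 𝔭.asIdeal, r • q = 0)
    (hgcoker : ∀ 𝔭 : PrimeSpectrum R, 𝔭.asIdeal.height ≤ 1 → ϖ ∉ 𝔭.asIdeal → ∀ y : H ⧸ C, ∃ r ∉ 𝔭.asIdeal, r • y ∈ LinearMap.range g)
    (hCZ : ∀ 𝔭 : PrimeSpectrum R, 𝔭.asIdeal.height ≤ 1 → ϖ ∉ 𝔭.asIdeal → ∀ z ∈ Z, ∃ r ∉ 𝔭.asIdeal, r • z ∈ C)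
    (hZC : ∀ 𝔭 : PrimeSpectrum R, 𝔭.asIdeal.height ≤ 1 → ϖ ∉ 𝔭.asIdeal → ∀ c ∈ C, ∃ r ∉ 𝔭.asIdeal, r • c ∈ Z) :
    ∃ i i' : ℕ, Module.charIdeal R Q * Ideal.span {ϖ} ^ i = Module.charIdeal R (H ⧸ Z) * Ideal.span {ϖ} ^ i' := by
  have hHC : Module.IsTorsion R (H ⧸ C) := isTorsion_quotient_of_away hϖ Z C hHZ hCZ
  -- `Q ≐ H/C`
  have h₁ := exists_charIdeal_mul_pow_eq_of_away_ker_coker hϖ hQ hHC g hgker hgcoker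
  -- `H/C ≐ H/(C ⊔ Z)` and `H/Z ≐ H/(Z ⊔ C) = H/(C ⊔ Z)`
  have h₂ := exists_charIdeal_quotient_mul_pow_eq_quotient_sup hϖ Z C hHC hCZ
  have h₃ := exists_charIdeal_quotient_mul_pow_eq_quotient_sup hϖ C Z hHZ hZC
  rw [sup_comm Z C] at h₃
  exact exists_mul_pow_eq_trans _ h₁ (exists_mul_pow_eq_trans _ h₂ (exists_mul_pow_eq_symm _ h₃))

end Summit.BirchSwinnertonDyer.BirchSwinnertonDyer.Theorems.PrintCf2.RowTwo

end
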